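import Summits.ResolutionOfSingularities.ResolutionOfSingularities.Theorems.EquisingularLiftEquisingularLiftNatTowerBTriplePrimeRoundClosure
import Summits.ResolutionOfSingularities.ResolutionOfSingularities.Theorems.EquisingularLiftEquisingularLiftNatResidueHypDefsE9
import HarnessLib

/-!
# [OURS · L1 W4.5(b) · EL♮(3) · WIDTH TABLE D17 «STAGE-0 TOWER BOOKKEEPING», engine (n4)] THE CARRIER-FREE ROUND `TowerRoundB₅` IS CLOSED ON THE STAGE-0 MOTIVE
# `INV₀ := InvB₄ FE … ∧ K-side facts` — ★★ `Tower.towerRoundB₅_invB₄_of_fact`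

res-L1-w45b-nose-w1 g7 (WIDTH seat D-0157 DOOR 1; desk RULING R82 (A) «nose-w1 g7: TAKE … (n4) `Tower.towerRoundB₅_invB₄_of_fact`»; sizing res-L1-w45b-idea-2
`D17-SIZING-idea2.md` c53e9159a56ae8bd (E-c); rule ✓ res-type-027 DefsE9 p719436 (T2)).  = ✓ `Tower.towerRoundBTriplePrime_invB₄_of_fact` (res-L1-w45b-stub-4,
…NatTowerBTriplePrimeRoundClosure) RE-CUT for the carrier-free rule: the motive loses the carrier-dimension rider `hcar` (nothing reads it once `TowerFull` is gone),
branch 1's section sub-branch 1(i) is gone with the rule's, and the curve clause `hZdim` is READ FROM THE LETTER in branches 1–3 instead of being derived from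
`TowerFull` + `hcar`; the three cores ✓ `Tower.invB₄_embRound_of_fact_anyPrime` / ✓ `Tower.invB₄_coneRound_of_anyPrime` / ✓ `Tower.invB₄_pairRound_of_fact`, the
shadow lemma ✓ `Tower.invB₄_shadow_of_disjoint`, the `Ns'` menu ✓ `Tower.ns'_menu_of_append` and branch 4 (K-fibre) are used BY NAME, bytes otherwise verbatim.
Conditional on (T-k) `EmbeddedCurveLift O k θ P q` exactly like the B‴ closure.  OURS; NOT a statement of any manuscript ([Hironaka2017] is a candidate under
adjudication, nothing of it is asserted); AI-written, weaker than expert review.  DEF-FREE; no `sorry`; standard axioms.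
`--kind proof --supports stmt-ResolutionOfSingularities-20148 --as helper`, counted 0.  EL♮(3) is NOT proved here.  [folklore; re-cut of ✓ modules]
-/

set_option linter.dupNamespace false -- mandated namespace `Summit.<Summit>.<Problem>` of this single-conjunct summit
set_option linter.overlappingInstances false -- signatures carry `[IsDomain O] [IsDiscreteValuationRing O]`

noncomputable section

open CategoryTheory CategoryTheory.Limits AlgebraicGeometry TopologicalSpace Topology IsLocalRing
open Literature.AlgebraicGeometry.Resolution
open AlgebraicGeometry.Scheme.IdealSheafData
open Summit.ResolutionOfSingularities.ResolutionOfSingularities.Theses.EquisingularLift.Split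
open Summit.ResolutionOfSingularities.ResolutionOfSingularities.Cruxes.EquisingularLift.StrataSplit

namespace Summit.ResolutionOfSingularities.ResolutionOfSingularities.Cruxes.EquisingularLiftNat.Sections

section RoundB5

variable (O : Type) [CommRing O] [IsDomain O] [IsDiscreteValuationRing O] (k : Type) [Field k]
    (θ : O →+* k) (hθ : Function.Surjective θ)
    (P : Scheme.{0}) [IsIntegral P] (q : P ⟶ Spec (.of O)) [IsProper q] [SmoothOfRelativeDimension 3 q] (Y : Set P)
    (hYsp : Y ⊆ q ⁻¹' {IsLocalRing.closedPoint O}) (hYirr : IsIrreducible Y) (hYcl : IsClosed Y)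
    (hPnoeth : IsLocallyNoetherian P) (hPreg : Scheme.IsRegular P)
    (Ch : ∀ X' : Scheme.{0}, (X' ⟶ P) → Set X' → Prop)
    (hChStep : ∀ (X' X'' : Scheme.{0}) (σ' : X' ⟶ P) (S' : Set X') (C : X'.IdealSheafData) (τ : X'' ⟶ X'),
      Ch X' σ' S' → IsBlowup τ C → Scheme.IsRegular C.subscheme → Flat (C.subschemeι ≫ σ' ≫ q) →
      σ' '' (C.support : Set X') ⊆ {y | ¬ IsGenericPoint y Y} → (C.support : Set X') ∩ (σ' ≫ q) ⁻¹' {IsLocalRing.closedPoint O} ⊆ S' →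
      Ch X'' (τ ≫ σ') (closure (τ ⁻¹' (S' \ (C.support : Set X')))))
    (hChSplit : ∀ (X' : Scheme.{0}) (σ' : X' ⟶ P) (S' : Set X'), Ch X' σ' S' → Chain P Y X' σ' S')

include hθ hYsp hYirr hYcl hPnoeth hPreg hChStep hChSplit

/-- ★★ **THE CARRIER-FREE ROUND `TowerRoundB₅` ON `INV₀`** (D17 engine (n4); see the module docstring): the four branches of ✓ DefsE9's (T2) dispatched to the
T23-A‴ cores with the curve clause taken from the letter. [OURS · L1 W4.5b · D17 engine; counted 0; EL♮(3) NOT proved] -/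
theorem Tower.towerRoundB₅_invB₄_of_fact (hFact : EmbeddedCurveLift O k θ P q) :
    ∀ {F₉ : Scheme.{0}} (Z₉ : Set F₉) (hZ₉ : IsClosed Z₉) {F₁₀ : Scheme.{0}} (υ' : F₁₀ ⟶ F₉),
      TowerRoundB₅ F₁₀ (fun G γ T E Es Ns K =>
        Tower.InvB₄ O k θ P q Y Ch (fun _ _ _ _ _ _ _ _ _ σ _ 𝓔 => Flat (𝓔.subschemeι ≫ σ ≫ q)) F₉ Z₉ hZ₉ F₁₀ υ' G γ T E Es Ns K ∧
          IsClosed K ∧ K ⊆ closure (K \ E) ∧ K ≠ Set.univ) := by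
  intro F₉ Z₉ hZ₉ F₁₀ υ' G G' γ T E Es Ns K hE Z hZ Hst W υ₂ K' E' Es' Ns' hI hZT hZne hadm hυ₂ hEs' hNs'
  -- the three rounds of fact‴ at `FE` (res-L1-w45b-stub-2)
  have hEmbB := Tower.invB₄_embRound_of_fact_anyPrime O k θ hθ P q Y hYsp hYirr hYcl hPnoeth hPreg Ch hChStep hChSplit hFact Z₉ hZ₉ υ'
  have hConeB := Tower.invB₄_coneRound_of_anyPrime O k θ hθ P q Y hYirr hYcl hPnoeth hPreg Ch hChStep hChSplit Z₉ hZ₉ υ'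
  have hPairB := Tower.invB₄_pairRound_of_fact O k θ hθ P q Y hYirr hYcl hPnoeth hPreg Ch hChStep hChSplit
    (fun {_ _} _ {_ _ _ _ _ _ _ _ _} hXreg hsq hθ' hprop hE1 hE2 hF1 hF2 hW1 hW2 hWdim => by
      haveI := hprop
      exact isRegular_subscheme_sup_of_trace_crossing hXreg hsq hθ' hE1 hE2 hF1 hF2 hW1 hW2 hWdim)
    (fun {_ _} _ {_ _ _ _ _ _ _ _ _} hXreg hsq hθ' hprop hE1 hE2 hF1 hF2 hW1 hW2 hWdim => by
      haveI := hprop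
      exact flat_subschemeι_sup_of_trace_crossing hXreg hsq hθ' hE1 hE2 hF1 hF2 hW1 hW2 hWdim)
    Z₉ hZ₉ υ'
  have hNs'' := Tower.ns'_menu_of_append hNs'
  have hGint : IsIntegral G := hI.1.2.2.1
  haveI := hGint
  haveI : IsLocallyNoetherian G := by
    obtain ⟨-, -, -, -, -, -, -, -, -, X, σ, S, jG, tG, -, -, hXnoeth, -, -, hsq, -, -⟩ := hI.1
    haveI := hXnoeth
    haveI : IsClosedImmersion (Spec.map (CommRingCat.ofHom θ)) := IsClosedImmersion.spec_of_surjective _ hθ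
    haveI : IsClosedImmersion jG := MorphismProperty.IsStableUnderBaseChange.of_isPullback hsq.flip inferInstance
    exact LocallyOfFiniteType.isLocallyNoetherian jG
  have hZsupp : ((vanishingIdeal (⟨Z, hZ⟩ : Closeds G) : G.IdealSheafData).support : Set G) = Z :=
    Scheme.IdealSheafData.coe_support_vanishingIdeal _
  -- the B′-shape `Es'` menu for the single-host branches (`W = Hst`: the co-host alternative folds into `F = Hst`)
  have hEs'1_of : W = Hst → ∀ F' ∈ Es', ∃ F ∈ E :: Es, RoundTransportOKPrime υ₂ Z hZ Hst F F' := fun hWH F' hF' => by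
    obtain ⟨F, hF, h1, h2⟩ := hEs' F' hF'
    refine ⟨F, hF, ?_, h2⟩
    rcases h1 with h | h | h | h
    · exact Or.inl h
    · exact Or.inl (h.trans hWH)
    · exact Or.inr (Or.inl h)
    · exact Or.inr (Or.inr h)
  -- the shadow replacement used by the «host ∈ Es» cases (branch 2, pair case C)
  have hShadow : ∀ {Hst : Set G}, ¬ T ⊆ Hst → Z ⊆ Hst →
      (Tower.InvB₄ O k θ P q Y Ch (fun _ _ _ _ _ _ _ _ _ σ _ 𝓔 => Flat (𝓔.subschemeι ≫ σ ≫ q)) F₉ Z₉ hZ₉ F₁₀ υ' G' (υ₂ ≫ γ)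
        (closure (υ₂ ⁻¹' (T \ Z))) (υ₂ ⁻¹' Z) Es' Ns' ∅) →
      (K' = ∅ ∨ (Disjoint Z (closure K) ∧ K' = closure (υ₂ ⁻¹' (K \ Z)))) →
      (Tower.InvB₄ O k θ P q Y Ch (fun _ _ _ _ _ _ _ _ _ σ _ 𝓔 => Flat (𝓔.subschemeι ≫ σ ≫ q)) F₉ Z₉ hZ₉ F₁₀ υ' G' (υ₂ ≫ γ)
          (closure (υ₂ ⁻¹' (T \ Z))) (υ₂ ⁻¹' Z) Es' Ns' K' ∧
        IsClosed K' ∧ K' ⊆ closure (K' \ υ₂ ⁻¹' Z) ∧ K' ≠ Set.univ) := by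
    intro Hst hTHst hZH hB₀ hK'
    have hG'int : IsIntegral G' := hB₀.2.2.1
    haveI := hG'int
    rcases hK' with rfl | ⟨hZK, rfl⟩
    · exact ⟨hB₀, isClosed_empty, Set.empty_subset _, Set.empty_ne_univ⟩
    · obtain ⟨-, hKcl, -, hKne⟩ := hI
      have hTZ : ¬ T ⊆ Z := fun h => hTHst (h.trans hZH)
      have hsub : closure (υ₂ ⁻¹' (K \ Z)) ⊆ υ₂ ⁻¹' closure K :=
        closure_minimal (fun z hz => subset_closure hz.1) (isClosed_closure.preimage υ₂.continuous)
      have hEK : Disjoint (υ₂ ⁻¹' Z) (closure (closure (υ₂ ⁻¹' (K \ Z)))) := by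
        rw [closure_closure]
        refine Set.disjoint_left.mpr fun z hzZ hzK => ?_
        exact (Set.disjoint_left.mp hZK) hzZ (hsub hzK)
      refine ⟨Tower.invB₄_shadow_of_disjoint O k θ P q Y Ch _ F₉ Z₉ hZ₉ F₁₀ υ' G' (υ₂ ≫ γ) _ _ Es' Ns' _ hB₀ hEK, isClosed_closure, ?_, ?_⟩
      · refine closure_minimal (fun z hz => subset_closure ⟨subset_closure hz, fun hzZ => ?_⟩) isClosed_closure
        exact (Set.disjoint_left.mp hEK) hzZ (subset_closure (subset_closure hz))
      · exact closure_preimage_ne_univ υ₂ _ hυ₂ K Z hKcl hKne hZ (fun h => hTZ (h ▸ Set.subset_univ _)) hZsupp.le _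
          (Set.preimage_mono fun z hz => hz.1)
  rcases hadm with ⟨hZdim, hWH, hHst, hZE, ⟨-, hZreg, -, hEZreg, hunobs⟩, hE', hK'⟩ |
      ⟨hZdim, hWH, hHmem, hF, hZH, hirr, hZreg, hGreg, hHZreg, hunobs, hE', hK'⟩ |
      ⟨hZdim, hHmem, hWmem, hHW, hH, hW, hpair, hZreg, hE', hK'⟩ | ⟨hWH, hHst, hZE, hcone, hE', hK'⟩
  · -- branch 1: host = the running surface `E` (shadow `K`); `W = Hst = E`; curve clause `hZdim` from the letter (carrier-free, D17 (T2))
    have hEs'1 := hEs'1_of hWH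
    subst hHst
    have hZET : Z ⊆ Hst ∩ T := fun z hz => ⟨hZE hz, hZT hz⟩
    rcases hK' with hK0 | ⟨hcone | hoff, hKst⟩
    · exact hEmbB G G' γ T Hst Es Ns K Hst K hE Z hZ υ₂ K' E' Es' Ns' hI (Or.inl ⟨rfl, rfl⟩) hZET hZne
        hZreg hEZreg hunobs hZdim hυ₂ (Or.inl hK0) hE' hEs'1 hNs''
    · exact hConeB G G' γ T Hst Es Ns K hE Z hZ υ₂ K' E' Es' Ns' hI hZET hZne hcone hυ₂ (Or.inr hKst) hE' hEs'1 hNs''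
    · exact hEmbB G G' γ T Hst Es Ns K Hst K hE Z hZ υ₂ K' E' Es' Ns' hI (Or.inl ⟨rfl, rfl⟩) hZET hZne
        hZreg hEZreg hunobs hZdim hυ₂ (Or.inr ⟨hoff, hKst⟩) hE' hEs'1 hNs''
  · -- branch 2: host = a RETAINED model-carrying member `Hst ∈ Es` (shadow `∅`), `W = Hst`; `hZdim` from the letter
    have hEs'1 := hEs'1_of hWH
    have hZHT : Z ⊆ Hst ∩ T := fun z hz => ⟨hZH hz, hZT hz⟩
    have hTHst : ¬ T ⊆ Hst := (hI.1.2.2.2.2.2.2.2.1 Hst hHmem).2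
    obtain ⟨hB₀, -, -, -⟩ := hEmbB G G' γ T E Es Ns K Hst ∅ hF Z hZ υ₂ ∅ E' Es' Ns' hI (Or.inr ⟨hHmem, rfl⟩) hZHT hZne hZreg
      hHZreg hunobs hZdim hυ₂ (Or.inl rfl) (Or.inl hE') hEs'1 hNs''
    subst hE'
    exact (hShadow hTHst hZH hB₀ hK')
  · -- branch 3: the PAIR round (full or FIBRE), centre `Z = Hst ∩ W` — cases A / B / C as in B″
    subst hE'
    have hWc : closure W = W := hW.closure_eq
    have hHc : closure Hst = Hst := hH.closure_eq
    have hZH : Z ⊆ Hst := fun z hz => by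
      have h := hpair.1 ▸ hz
      exact h.1
    -- the shadow menu when the running surface takes part (cases A/B)
    have hKmenu : (Hst = E ∨ W = E) → K' = ∅ ∨ (closure (Z \ closure K) = Z ∧ K' = closure (υ₂ ⁻¹' (K \ Z))) := by
      intro hor
      rcases hK' with h | ⟨h, hKst⟩
      · exact Or.inl h
      · refine Or.inr ⟨?_, hKst⟩
        rcases h with ⟨-, h⟩ | hdisj
        · exact h
        · rw [hdisj.sdiff_eq_left, hZ.closure_eq]
    by_cases hHE : Hst = E
    · -- case A: the running surface hosts, with its shadow
      exact (hPairB G G' γ T E Es Ns K Hst K hH Z hZ W hW υ₂ K' (υ₂ ⁻¹' Z) Es' Ns' hI (Or.inl ⟨hHE, rfl⟩) hWmem hpair hZT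
        hZne hZreg hZdim hυ₂ (hKmenu (Or.inl hHE)) (Or.inl rfl) hEs' hNs'')
    · by_cases hWE : W = E
      · -- case B: the running surface is the WITNESS — swap the roles (`ConeWitness` is symmetric for closed sets)
        have hEcl' : IsClosed E := hWE ▸ hW
        obtain ⟨hZeq, hwit⟩ := hpair
        have hpair' : ConeWitness G E hEcl' Hst Z hZ := by
          refine ⟨?_, ?_⟩
          · rw [hWc, hWE] at hZeq
            rw [hHc, Set.inter_comm]; exact hZeq
          · have h1 : (⟨closure Hst, isClosed_closure⟩ : Closeds G) = ⟨Hst, hH⟩ := Closeds.ext hHc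
            have h2 : (⟨closure W, isClosed_closure⟩ : Closeds G) = ⟨E, hEcl'⟩ := Closeds.ext (hWc.trans hWE)
            rw [h1, sup_comm, ← h2]; exact hwit
        have hEs'B : ∀ F' ∈ Es', ∃ F ∈ E :: Es,
            (F = E ∨ F = Hst ∨ Disjoint Z F ∨
              ∃ hF : IsClosed F,
                (∀ g ∈ Z ∩ F, stalkIdeal (vanishingIdeal (⟨Z, hZ⟩ : Closeds G)) g ⊔ stalkIdeal (vanishingIdeal (⟨F, hF⟩ : Closeds G)) g =
                    maximalIdeal (G.presheaf.stalk g)) ∧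
                  ∀ g ∈ Z ∩ F, stalkIdeal (vanishingIdeal (⟨Z, hZ⟩ : Closeds G)) g ≠ maximalIdeal (G.presheaf.stalk g)) ∧
            F' = closure (υ₂ ⁻¹' (F \ Z)) := fun F' hF' => by
          obtain ⟨F, hF', h1, h2⟩ := hEs' F' hF'
          refine ⟨F, hF', ?_, h2⟩
          rcases h1 with h | h | h
          · exact Or.inr (Or.inl h)
          · exact Or.inl (h.trans hWE)
          · exact Or.inr (Or.inr h)
        exact (hPairB G G' γ T E Es Ns K E K hEcl' Z hZ Hst hH υ₂ K' (υ₂ ⁻¹' Z) Es' Ns' hI (Or.inl ⟨rfl, rfl⟩) hHmem hpair'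
          hZT hZne hZreg hZdim hυ₂ (hKmenu (Or.inr hWE)) (Or.inl rfl) hEs'B hNs'')
      · -- case C: neither is the running surface: host `Hst ∈ Es` (`KH := ∅`); the shadow only under `Disjoint`
        have hHmemEs : Hst ∈ Es := (List.mem_cons.mp hHmem).resolve_left hHE
        have hTHst : ¬ T ⊆ Hst := (hI.1.2.2.2.2.2.2.2.1 Hst hHmemEs).2
        obtain ⟨hB₀, -, -, -⟩ := hPairB G G' γ T E Es Ns K Hst ∅ hH Z hZ W hW υ₂ ∅ (υ₂ ⁻¹' Z) Es' Ns' hI (Or.inr ⟨hHmemEs, rfl⟩) hWmem hpair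
          hZT hZne hZreg hZdim hυ₂ (Or.inl rfl) (Or.inl rfl) hEs' hNs''
        have hK'C : K' = ∅ ∨ (Disjoint Z (closure K) ∧ K' = closure (υ₂ ⁻¹' (K \ Z))) := by
          rcases hK' with h | ⟨h, hKst⟩
          · exact Or.inl h
          · rcases h with ⟨hor, -⟩ | h
            · exact absurd hor (not_or.mpr ⟨hHE, hWE⟩)
            · exact Or.inr ⟨h, hKst⟩
        exact (hShadow hTHst hZH hB₀ hK'C)
  · -- branch 4 (NEW, T23-A‴): the K-FIBRE round — shadow-witnessed round on the running surface, no `DirStepSec`, no dimension clause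
    have hEs'1 := hEs'1_of hWH
    subst hHst
    have hZET : Z ⊆ Hst ∩ T := fun z hz => ⟨hZE hz, hZT hz⟩
    exact (hConeB G G' γ T Hst Es Ns K hE Z hZ υ₂ K' E' Es' Ns' hI hZET hZne hcone hυ₂ hK' hE' hEs'1 hNs'')


end RoundB5

end Summit.ResolutionOfSingularities.ResolutionOfSingularities.Cruxes.EquisingularLiftNat.Sections

end
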